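import Mathlib
import HarnessLib.Audit
import Summits.PneNP.PneNP.Theorems.PstarCoincidenceChord

/-!
# The empty-core branch of a pair-core folds non-chords only (ROUND-24, O1 at exact tightness; memo g22 §21, Lemma X instantiated)

FRONTIER range-avoidance ladder, rung F-N3, ROUND 24 (cell `pnp-ideate`, prover-2 memo `g22/O1-PAIRCORE-g22.md` §21; typed target
`PstarCoreBoundTargets.TerminalPeelable` (p646951); restricted-model proof complexity — nothing here bears on `P` versus `NP`).

`PstarCoincidenceChord.false_of_chord_in_coincidence` (Lemma X) in the vocabulary of `PstarPairCoreNormal.PairCore.normalForm`'s empty-core branch: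

* `ne_singleton_of_even` — an everywhere-even `c + F₁` with `F₁ = {c'}` would make `c, c'` share both XOR variables (simple overlaps);
* **`no_chord_in_coincidence`** — data of the empty-core branch (`F₁, F₂ ⊆ K ⊆ J₀`, `G` disjoint from `K` inside the menu `𝒢`,
  `c + F₁` everywhere even, `(∅, F₁, β₁) ∧ (C₂, G ∪ F₂, β₂)` unsatisfiable over all assignments, the flip property on `K ∪ G`): then NO `c' ∈ F₁` is
  an OUTSIDE-GATED CHORD OF `J₀` (both AND variables `J₀`-private, every menu monomial touching them an outside gate — automatic at exact tightness,
  `PstarChordReadTight.outsideGated_of_tight`).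

Hence, on a tight twelve-output centre structure, the folded family `F₁` of a coincidence consists of half-chords only, and with the landed rank bound
(`≤ 2` AND-components) lies inside two σ-classes: the planner's census filter V5, which leaves `≥ 5` coincidence-free chords on every one of the 1800
structures (memo §21).  No Assumption A.
-/

set_option linter.dupNamespace false -- `Summit.PneNP.PneNP.…`: summit = sub-problem name (D-0017 single-conjunct layout)

open Finset Literature.Computability.Complexity
open Summit.PneNP.PneNP.Theorems.PstarSALevel (varSet bdry SimpleOverlap)
open Summit.PneNP.PneNP.Theorems.PstarGapPeeling (not_mem_varSet_of_private)
open Summit.PneNP.PneNP.Theorems.PstarCentreFree (vars_mem_varSet)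
open Summit.PneNP.PneNP.Theorems.PstarChordEndgameTools (not_two_shared)
open Summit.PneNP.PneNP.Theorems.PstarChordRepair (IsChord)
open Summit.PneNP.PneNP.Theorems.PstarGapOneAll (gval)
open Summit.PneNP.PneNP.Theorems.PstarGConstraint (andPairs_simple gval_nonconst_iff)
open Summit.PneNP.PneNP.Theorems.PstarChordBridgeTools (xpdeg)
open Summit.PneNP.PneNP.Theorems.PstarChordBridgeFundamental (xpdeg_insert)
open Summit.PneNP.PneNP.Theorems.PstarNorUnitAssembly (xpdeg_empty)
open Summit.PneNP.PneNP.Theorems.PstarChordReadOutside (OutsideGated IsGate exists_gate_of_slot)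
open Summit.PneNP.PneNP.Theorems.PstarCoincidenceChord (false_of_chord_in_coincidence)

namespace Summit.PneNP.PneNP.Theorems.PstarPairCoreNoChord

variable {n m : ℕ} {I : LocalMap 4 n m}

/-- **`c + {c'}` is never everywhere even** (simple overlaps, `c ≠ c'`): the two outputs would share both XOR variables. -/
theorem ne_singleton_of_even (hI : I.IsPure xorAndPred) (hS : SimpleOverlap I) {c c' : Fin m} (hne : c ≠ c') {F₁ : Finset (Fin m)}
    (hcF : c ∉ F₁) (heven : ∀ v, Even (xpdeg I (insert c F₁) v)) : F₁ ≠ {c'} := by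
  classical
  intro hF
  subst hF
  have h01 : I.vars c 0 ≠ I.vars c 1 := fun e => absurd (hI.2 c e) (by decide)
  have h01' : I.vars c' 0 ≠ I.vars c' 1 := fun e => absurd (hI.2 c' e) (by decide)
  have hc' : c' ∉ (∅ : Finset (Fin m)) := notMem_empty _
  -- slot degrees in `{c, c'}`
  have hdeg : ∀ v, xpdeg I (insert c {c'}) v = (if I.vars c 0 = v then 1 else 0) + (if I.vars c 1 = v then 1 else 0) +
      ((if I.vars c' 0 = v then 1 else 0) + (if I.vars c' 1 = v then 1 else 0)) := by
    intro v
    rw [xpdeg_insert I hcF, show ({c'} : Finset (Fin m)) = insert c' ∅ from rfl, xpdeg_insert I hc', xpdeg_empty]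
    ring
  -- each XOR variable of `c` is an XOR variable of `c'`
  have key : ∀ s : Fin 4, s = 0 ∨ s = 1 → I.vars c s ∈ varSet I c' := by
    intro s hs
    have h := heven (I.vars c s)
    rw [hdeg] at h
    rcases hs with rfl | rfl
    · rw [if_pos rfl, if_neg (Ne.symm h01)] at h
      by_cases h0 : I.vars c' 0 = I.vars c 0
      · exact h0 ▸ vars_mem_varSet I c' 0
      · by_cases h1 : I.vars c' 1 = I.vars c 0
        · exact h1 ▸ vars_mem_varSet I c' 1
        · rw [if_neg h0, if_neg h1] at h; exact absurd h (by decide)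
    · rw [if_neg h01, if_pos rfl] at h
      by_cases h0 : I.vars c' 0 = I.vars c 1
      · exact h0 ▸ vars_mem_varSet I c' 0
      · by_cases h1 : I.vars c' 1 = I.vars c 1
        · exact h1 ▸ vars_mem_varSet I c' 1
        · rw [if_neg h0, if_neg h1] at h; exact absurd h (by decide)
  exact not_two_shared I hS hne h01 (vars_mem_varSet I c 0) (key 0 (Or.inl rfl)) (vars_mem_varSet I c 1) (key 1 (Or.inr rfl))

/-- **THE EMPTY-CORE BRANCH FOLDS NON-CHORDS ONLY.**  In the empty-core branch of a pair-core for the chord `c` (data as produced by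
`PstarPairCoreNormal.PairCore.normalForm` with `K₀ = ∅`, the core `K ⊆ J₀`, the reader's monomials `G` inside a menu `𝒢` of outputs off `J₀`),
no folded output `c' ∈ F₁` is an outside-gated chord of `J₀`. -/
theorem no_chord_in_coincidence (hI : I.IsPure xorAndPred) (hS : SimpleOverlap I) {J₀ K F₁ F₂ G 𝒢 : Finset (Fin m)} {c : Fin m}
    {β₁ β₂ : Bool} {C₂ : Finset (Fin n)} (hKJ : K ⊆ J₀) (hcK : c ∉ K) (hF₁ : F₁ ⊆ K) (hF₂ : F₂ ⊆ K)
    (hdisj : Disjoint K G) (hG : G ⊆ 𝒢) (heven : ∀ v, Even (xpdeg I (insert c F₁) v))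
    (hU : ∀ z : Fin n → Bool, ¬ (gval I ∅ F₁ z = β₁ ∧ gval I C₂ (G ∪ F₂) z = β₂))
    (hflip : ∀ g ∈ K ∪ G, ∃ z : Fin n → Bool,
      (gval I ∅ F₁ z = β₁ ↔ g ∉ F₁) ∧ (gval I C₂ (G ∪ F₂) z = β₂ ↔ g ∉ G ∪ F₂))
    {c' : Fin m} (hc' : c' ∈ F₁) (hch : IsChord I J₀ c') (hO : OutsideGated I J₀ 𝒢 c') : False := by
  classical
  have hc'K : c' ∈ K := hF₁ hc'
  have hc'J : c' ∈ J₀ := hKJ hc'K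
  have hcF₁ : c ∉ F₁ := fun h => hcK (hF₁ h)
  -- privacy of the AND variables of `c'` in `J₀`
  have priv : ∀ j ∈ J₀, j ≠ c' → ∀ s : Fin 4, I.vars j s ≠ I.vars c' 2 ∧ I.vars j s ≠ I.vars c' 3 := by
    intro j hj hne s
    exact ⟨fun e => not_mem_varSet_of_private I hc'J hj hne hch.1 (vars_mem_varSet I c' 2) (e ▸ vars_mem_varSet I j s),
      fun e => not_mem_varSet_of_private I hc'J hj hne hch.2 (vars_mem_varSet I c' 3) (e ▸ vars_mem_varSet I j s)⟩
  refine false_of_chord_in_coincidence (β₁ := β₁) (C₂ := C₂) (G₂ := G ∪ F₂) (β₂ := β₂) hI hS hc' ?_ ?_ ?_ hU ?_ ?_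
  · -- `F₁ ≠ {c'}`
    rw [← card_pos, card_erase_of_mem hc', Nat.sub_pos_iff_lt, one_lt_card]
    by_contra hno
    push Not at hno
    refine ne_singleton_of_even hI hS (fun e => hcK (by rw [e]; exact hc'K)) hcF₁ heven (eq_singleton_iff_unique_mem.2 ⟨hc', fun f hf => ?_⟩)
    by_contra hfc
    exact hfc (hno f hf c' hc')
  · intro f hf hne
    have hfJ := hKJ (hF₁ hf)
    exact ⟨⟨(priv f hfJ hne 2).1, (priv f hfJ hne 3).1⟩, ⟨(priv f hfJ hne 2).2, (priv f hfJ hne 3).2⟩⟩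
  · intro g hg hne v z hv hpair f hf
    rcases mem_union.1 hg with hgG | hgF
    · -- a menu monomial: an outside gate on `c'`
      have hgv : I.vars g 2 = v ∨ I.vars g 3 = v := by
        rcases hpair with ⟨h2, -⟩ | ⟨-, h3⟩
        exacts [Or.inl h2, Or.inr h3]
      obtain ⟨z', hgate⟩ := exists_gate_of_slot hO hc'J (hG hgG) hv hgv
      have hvz : v ≠ z := by
        have h23 : I.vars g 2 ≠ I.vars g 3 := fun e => absurd (hI.2 g e) (by decide)
        rcases hpair with ⟨h2, h3⟩ | ⟨h2, h3⟩
        exacts [fun e => h23 (h2.trans (e.trans h3.symm)), fun e => h23 (h2.trans (e.symm.trans h3.symm))]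
      have hzz : z = z' := by
        rcases hpair with ⟨h2, h3⟩ | ⟨h2, h3⟩ <;> rcases hgate.2.1 with ⟨g2, g3⟩ | ⟨g2, g3⟩
        · exact h3.symm.trans g3
        · exact absurd (h3.symm.trans g3).symm hvz
        · exact absurd (h2.symm.trans g2).symm hvz
        · exact h2.symm.trans g2
      subst hzz
      have hzf : z ∉ varSet I f := hgate.2.2 f (hKJ (hF₁ hf))
      exact ⟨fun e => hzf (e ▸ vars_mem_varSet I f 2), fun e => hzf (e ▸ vars_mem_varSet I f 3)⟩
    · -- an output of `J₀` cannot touch a private of `c'`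
      exfalso
      have hgJ := hKJ (hF₂ hgF)
      rcases hv with rfl | rfl <;> rcases hpair with ⟨h2, -⟩ | ⟨-, h3⟩
      · exact (priv g hgJ hne 2).1 h2
      · exact (priv g hgJ hne 3).1 h3
      · exact (priv g hgJ hne 2).2 h2
      · exact (priv g hgJ hne 3).2 h3
  · -- `d₂` is satisfiable: its monomial set contains `c'` or a flip makes it true
    by_cases h : ∃ g ∈ F₁, g ∉ F₂
    · obtain ⟨g, hg₁, hg₂⟩ := h
      obtain ⟨z, -, hz₂⟩ := hflip g (mem_union_left _ (hF₁ hg₁))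
      refine ⟨z, hz₂.2 ?_⟩
      rw [mem_union, not_or]
      exact ⟨fun hgG => disjoint_left.1 hdisj (hF₁ hg₁) hgG, hg₂⟩
    · push Not at h
      have hne : (G ∪ F₂).Nonempty := ⟨c', mem_union_right _ (h c' hc')⟩
      obtain ⟨hnd, hdist⟩ := andPairs_simple I hI hS (G ∪ F₂)
      obtain ⟨z, z', hzz⟩ := (gval_nonconst_iff I hnd hdist).2 (Or.inr hne.ne_empty)
      by_cases hz : gval I C₂ (G ∪ F₂) z = β₂
      · exact ⟨z, hz⟩
      · refine ⟨z', ?_⟩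
        revert hz hzz
        cases gval I C₂ (G ∪ F₂) z <;> cases gval I C₂ (G ∪ F₂) z' <;> cases β₂ <;> decide
  · -- the flip of the common monomial `c'`
    intro hc'G
    obtain ⟨z, hz₁, hz₂⟩ := hflip c' (mem_union_left _ hc'K)
    exact ⟨z, fun h => (hz₁.1 h) hc', fun h => (hz₂.1 h) hc'G⟩

end Summit.PneNP.PneNP.Theorems.PstarPairCoreNoChord
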